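import Mathlib
import HarnessLib
import Literature.Analysis.FluidPDE.SpaceTimeCalculusC1
import Summits.NavierStokesRegularity.NavierStokesRegularity.Theorems.ChiralWindowDoorDefs
import Summits.NavierStokesRegularity.NavierStokesRegularity.Theorems.ChiralWindowDoorGagliardoIdentity
import Summits.NavierStokesRegularity.NavierStokesRegularity.Theorems.ChiralWindowDoorLocalHelicityLower
import Summits.NavierStokesRegularity.NavierStokesRegularity.Theorems.ChiralWindowDoorLocalDissipationPointwise
import Summits.NavierStokesRegularity.NavierStokesRegularity.Theorems.ChiralWindowDoorTimeIntegratedError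
import Summits.NavierStokesRegularity.NavierStokesRegularity.Theorems.PoloidalWindowDoorPoloidalWindowRigidityWindow

/-!
# Door S20 «ChiralWindowDoor» — stub B2′ `stub_localDissipationLower` PROVED: the localised helicity DISSIPATION of
# a chiral door-class profile is almost coercive, integrated in time, uniformly in `R`

Door S20 of nsreg-p1's local Type-I door family (`HOME/ns-regularity-ideate-p1/r19/R19-LINE.md` §B2′, line
`r19/Sketch20v5.lean` 7f13084196f4f031; DESIGN-ONLY, route NOT born).  Assembly of
`…LocalDissipationPointwise` (two-sided here: `|h_R(t) − G_R(t)| ≤ c₀ E_R(t)` from the Gagliardo–`Λ` IDENTITY, with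
`G_R(t) = gagliardo a_R (curl v(t))`, `h_R(t) = locHelicity a_R (curl v(t))`) and `…TimeIntegratedError`
(`∫_{t<0} E_R ≤ c₁(η)`, `E_R` integrable).  The time integrals of `G_R` and `h_R` are Bochner integrals with junk
value `0`; the two-sided bound makes the integrability of `G_R` and `h_R` on `(−∞,t₀)` EQUIVALENT (given their
measurability in `t`, which follows from the joint smoothness of the profile on the open backward slab:
`(t,x) ↦ curl v(t)(x)` and `(t,x) ↦ curl curl v(t)(x)` are jointly continuous), so either both are integrable and
`∫G ≤ ∫h + c₀c₁`, or neither is and both integrals vanish.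

* `contDiffOn_uncurry_fderiv_slice`, `continuousOn_uncurry_curl`, `continuousOn_uncurry_curl_curl` — joint regularity;
* `aestronglyMeasurable_locHelicity_curl`, `aestronglyMeasurable_gagliardo_curl` — measurability in `t`;
* `abs_locHelicity_sub_gagliardo_le` — the two-sided pointwise bound;
* `localDissipationLower` — **stub B2′ of `r19/Sketch20v5.lean` (text verbatim over the tree substrate), PROVED.**

Seat nsreg-p6 g11 (THEOREMS-ONLY door sequels, DIRECTOR-NS g8 #32 (2)/#36).  WHAT THIS IS NOT: not NS regularity
(Clay A); not K2 — with B1′, B2′, B5b proved, the residue line's OPEN stubs are B3 (helicity budget) and B5a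
(Gagliardo-form fractional Sobolev + Fatou), plus the spread input and K1; no route is opened.
-/

noncomputable section

-- the summit and its single sub-problem share the name (CONVENTIONS §1), as in every Theorems file
set_option linter.dupNamespace false

namespace Summit.NavierStokesRegularity.NavierStokesRegularity.Theorems.ChiralWindowDoorLocalDissipationLower

open MeasureTheory Set Filter Topology Metric Function
open scoped RealInnerProductSpace
open Literature.Analysis Literature.Analysis.FluidPDE
open Summit.NavierStokesRegularity.NavierStokesRegularity.Theorems.ChiralWindowDoorDefs
open Summit.NavierStokesRegularity.NavierStokesRegularity.Theorems.ChiralWindowDoorGagliardoIdentity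
open Summit.NavierStokesRegularity.NavierStokesRegularity.Theorems.ChiralWindowDoorLocalHelicityLower
open Summit.NavierStokesRegularity.NavierStokesRegularity.Theorems.ChiralWindowDoorLocalDissipationPointwise
open Summit.NavierStokesRegularity.NavierStokesRegularity.Theorems.ChiralWindowDoorTimeIntegratedError
open Summit.NavierStokesRegularity.NavierStokesRegularity.Theorems.PoloidalWindowDoorPoloidalWindowRigidityWindow
  (isTypeIAncientMild_of_class)

/-! ### Joint regularity of the vorticity and of its curl on the open backward slab -/

section Joint

variable {v : ℝ → EuclideanSpace ℝ (Fin 3) → EuclideanSpace ℝ (Fin 3)}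

/-- Joint `Cᵐ` regularity of the slice derivative `(t,x) ↦ D(v t)(x)` from joint `Cᵐ⁺¹` regularity of `v` on the
open backward slab. -/
theorem contDiffOn_uncurry_fderiv_slice {N m : WithTop ℕ∞}
    (hv : ContDiffOn ℝ N (uncurry v) (Iio (0 : ℝ) ×ˢ univ)) (hm : m + 1 ≤ N) :
    ContDiffOn ℝ m (fun p : ℝ × EuclideanSpace ℝ (Fin 3) => fderiv ℝ (v p.1) p.2) (Iio (0 : ℝ) ×ˢ univ) := by
  have hS : UniqueDiffOn ℝ (Iio (0 : ℝ) ×ˢ (univ : Set (EuclideanSpace ℝ (Fin 3)))) :=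
    (uniqueDiffOn_Iio 0).prod uniqueDiffOn_univ
  have h1 : ContDiffOn ℝ m (fun p => fderivWithin ℝ (uncurry v) (Iio (0 : ℝ) ×ˢ univ) p)
      (Iio (0 : ℝ) ×ˢ univ) := hv.fderivWithin hS hm
  have h2 : ContDiffOn ℝ m (fun p : ℝ × EuclideanSpace ℝ (Fin 3) =>
      (fderivWithin ℝ (uncurry v) (Iio (0 : ℝ) ×ˢ univ) p).comp
        (ContinuousLinearMap.inr ℝ ℝ (EuclideanSpace ℝ (Fin 3)))) (Iio (0 : ℝ) ×ˢ univ) :=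
    ((ContinuousLinearMap.compL ℝ (EuclideanSpace ℝ (Fin 3)) (ℝ × EuclideanSpace ℝ (Fin 3))
      (EuclideanSpace ℝ (Fin 3))).flip
      (ContinuousLinearMap.inr ℝ ℝ (EuclideanSpace ℝ (Fin 3)))).contDiff.comp_contDiffOn h1
  have h1N : (1 : WithTop ℕ∞) ≤ N := le_trans le_add_self hm
  refine h2.congr fun p hp => ?_
  rcases p with ⟨t, x⟩
  exact fderiv_slice_eq_of_contDiffOn (hv.of_le h1N) (mem_prod.1 hp).1 x

/-- Joint `Cᵐ` regularity of the vorticity `(t,x) ↦ curl (v t) x` from joint `Cᵐ⁺¹` regularity of `v`. -/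
theorem contDiffOn_uncurry_curl {N m : WithTop ℕ∞}
    (hv : ContDiffOn ℝ N (uncurry v) (Iio (0 : ℝ) ×ˢ univ)) (hm : m + 1 ≤ N) :
    ContDiffOn ℝ m (uncurry fun t x => curl (v t) x) (Iio (0 : ℝ) ×ˢ univ) := by
  have h := curlCLM.contDiff.comp_contDiffOn (contDiffOn_uncurry_fderiv_slice hv hm)
  refine h.congr fun p _ => ?_
  rcases p with ⟨t, x⟩
  exact curl_eq_curlCLM _ _

/-- Joint continuity of the vorticity on the open backward slab (`v` jointly `C¹`). -/
theorem continuousOn_uncurry_curl (hv : ContDiffOn ℝ 1 (uncurry v) (Iio (0 : ℝ) ×ˢ univ)) :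
    ContinuousOn (fun p : ℝ × EuclideanSpace ℝ (Fin 3) => curl (v p.1) p.2) (Iio (0 : ℝ) ×ˢ univ) :=
  (contDiffOn_uncurry_curl (m := 0) hv (by norm_num)).continuousOn

/-- Joint continuity of the curl of the vorticity on the open backward slab (`v` jointly `C²`). -/
theorem continuousOn_uncurry_curl_curl (hv : ContDiffOn ℝ 2 (uncurry v) (Iio (0 : ℝ) ×ˢ univ)) :
    ContinuousOn (fun p : ℝ × EuclideanSpace ℝ (Fin 3) => curl (curl (v p.1)) p.2) (Iio (0 : ℝ) ×ˢ univ) := by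
  have h1 : ContDiffOn ℝ 1 (uncurry fun t x => curl (v t) x) (Iio (0 : ℝ) ×ˢ univ) :=
    contDiffOn_uncurry_curl (m := 1) hv (by norm_num)
  exact (contDiffOn_uncurry_curl (v := fun t x => curl (v t) x) (m := 0) h1 (by norm_num)).continuousOn

end Joint

/-! ### Measurability in time of the two functionals of the vorticity slice -/

section Measurability

variable {v : ℝ → EuclideanSpace ℝ (Fin 3) → EuclideanSpace ℝ (Fin 3)} {η : EuclideanSpace ℝ (Fin 3) → ℝ}

/-- The restricted product measure on a time–space slab. -/
theorem prod_restrict_Iio (t₀ : ℝ) {X : Type*} [MeasurableSpace X] (ν : Measure X) [SFinite ν] :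
    ((volume : Measure ℝ).restrict (Iio t₀)).prod ν = ((volume : Measure ℝ).prod ν).restrict (Iio t₀ ×ˢ univ) := by
  conv_lhs => rw [← Measure.restrict_univ (μ := ν)]
  rw [Measure.prod_restrict]

/-- **`t ↦ locHelicity (bumpSq η R) (curl (v t))` is a.e.-strongly measurable on `(−∞, t₀)`, `t₀ ≤ 0`.** -/
theorem aestronglyMeasurable_locHelicity_curl (hv : ContDiffOn ℝ 2 (uncurry v) (Iio (0 : ℝ) ×ˢ univ))
    (hη : IsAdmissibleBump η) (R : ℝ) {t₀ : ℝ} (ht₀ : t₀ ≤ 0) :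
    AEStronglyMeasurable (fun t => locHelicity (bumpSq η R) (curl (v t))) (volume.restrict (Iio t₀)) := by
  set F : ℝ × EuclideanSpace ℝ (Fin 3) → ℝ := fun q =>
    bumpSq η R q.2 * ⟪curl (v q.1) q.2, curl (curl (v q.1)) q.2⟫ with hF
  have hsub : Iio t₀ ×ˢ (univ : Set (EuclideanSpace ℝ (Fin 3))) ⊆ Iio (0 : ℝ) ×ˢ univ :=
    prod_mono (Iio_subset_Iio ht₀) subset_rfl
  have hω := (continuousOn_uncurry_curl (hv.of_le (by norm_num))).mono hsub
  have hωω := (continuousOn_uncurry_curl_curl hv).mono hsub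
  have hFc : ContinuousOn F (Iio t₀ ×ˢ univ) := by
    rw [hF]
    exact ((continuous_bumpSq hη R).comp continuous_snd).continuousOn.mul (hω.inner hωω)
  have hFm0 : AEStronglyMeasurable F ((volume : Measure (ℝ × EuclideanSpace ℝ (Fin 3))).restrict (Iio t₀ ×ˢ univ)) :=
    hFc.aestronglyMeasurable (measurableSet_Iio.prod MeasurableSet.univ)
  have hFm : AEStronglyMeasurable F (((volume : Measure ℝ).restrict (Iio t₀)).prod volume) := by
    rw [prod_restrict_Iio]; exact hFm0
  exact hFm.integral_prod_right'

/-- **`t ↦ gagliardo (bumpSq η R) (curl (v t))` is a.e.-strongly measurable on `(−∞, t₀)`, `t₀ ≤ 0`.** -/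
theorem aestronglyMeasurable_gagliardo_curl (hv : ContDiffOn ℝ 2 (uncurry v) (Iio (0 : ℝ) ×ˢ univ))
    (hη : IsAdmissibleBump η) (R : ℝ) {t₀ : ℝ} (ht₀ : t₀ ≤ 0) :
    AEStronglyMeasurable (fun t => gagliardo (bumpSq η R) (curl (v t))) (volume.restrict (Iio t₀)) := by
  set Φ : ℝ × (EuclideanSpace ℝ (Fin 3) × EuclideanSpace ℝ (Fin 3)) → ℝ := fun q =>
    (bumpSq η R q.2.1 + bumpSq η R q.2.2) *
      (lamK (q.2.1 - q.2.2) * ‖curl (v q.1) q.2.1 - curl (v q.1) q.2.2‖ ^ 2) with hΦ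
  have hsub : Iio t₀ ×ˢ (univ : Set (EuclideanSpace ℝ (Fin 3))) ⊆ Iio (0 : ℝ) ×ˢ univ :=
    prod_mono (Iio_subset_Iio ht₀) subset_rfl
  have hω := (continuousOn_uncurry_curl (hv.of_le (by norm_num))).mono hsub
  -- the two vorticity evaluations `(t,p) ↦ ω(t,p.1)`, `(t,p) ↦ ω(t,p.2)` are continuous on the slab
  have hmaps1 : MapsTo (fun q : ℝ × (EuclideanSpace ℝ (Fin 3) × EuclideanSpace ℝ (Fin 3)) => (q.1, q.2.1))
      (Iio t₀ ×ˢ univ) (Iio t₀ ×ˢ univ) := fun q hq => ⟨(mem_prod.1 hq).1, mem_univ _⟩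
  have hmaps2 : MapsTo (fun q : ℝ × (EuclideanSpace ℝ (Fin 3) × EuclideanSpace ℝ (Fin 3)) => (q.1, q.2.2))
      (Iio t₀ ×ˢ univ) (Iio t₀ ×ˢ univ) := fun q hq => ⟨(mem_prod.1 hq).1, mem_univ _⟩
  have hπ1 : Continuous (fun q : ℝ × (EuclideanSpace ℝ (Fin 3) × EuclideanSpace ℝ (Fin 3)) => (q.1, q.2.1)) :=
    continuous_fst.prodMk (continuous_fst.comp continuous_snd)
  have hπ2 : Continuous (fun q : ℝ × (EuclideanSpace ℝ (Fin 3) × EuclideanSpace ℝ (Fin 3)) => (q.1, q.2.2)) :=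
    continuous_fst.prodMk (continuous_snd.comp continuous_snd)
  have hω1 : ContinuousOn (fun q : ℝ × (EuclideanSpace ℝ (Fin 3) × EuclideanSpace ℝ (Fin 3)) =>
      curl (v q.1) q.2.1) (Iio t₀ ×ˢ univ) := by
    have h := hω.comp hπ1.continuousOn hmaps1
    exact h
  have hω2 : ContinuousOn (fun q : ℝ × (EuclideanSpace ℝ (Fin 3) × EuclideanSpace ℝ (Fin 3)) =>
      curl (v q.1) q.2.2) (Iio t₀ ×ˢ univ) := by
    have h := hω.comp hπ2.continuousOn hmaps2
    exact h
  have hcont : ContinuousOn (fun q : ℝ × (EuclideanSpace ℝ (Fin 3) × EuclideanSpace ℝ (Fin 3)) =>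
      ‖curl (v q.1) q.2.1 - curl (v q.1) q.2.2‖ ^ 2) (Iio t₀ ×ˢ univ) := ((hω1.sub hω2).norm).pow 2
  have hmeasSlab : MeasurableSet (Iio t₀ ×ˢ (univ : Set (EuclideanSpace ℝ (Fin 3) × EuclideanSpace ℝ (Fin 3)))) :=
    measurableSet_Iio.prod MeasurableSet.univ
  have hΦm0 : AEStronglyMeasurable Φ
      ((volume : Measure (ℝ × (EuclideanSpace ℝ (Fin 3) × EuclideanSpace ℝ (Fin 3)))).restrict (Iio t₀ ×ˢ univ)) := by
    have h1 : AEStronglyMeasurable (fun q : ℝ × (EuclideanSpace ℝ (Fin 3) × EuclideanSpace ℝ (Fin 3)) =>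
        bumpSq η R q.2.1 + bumpSq η R q.2.2)
        ((volume : Measure (ℝ × (EuclideanSpace ℝ (Fin 3) × EuclideanSpace ℝ (Fin 3)))).restrict (Iio t₀ ×ˢ univ)) :=
      (((continuous_bumpSq hη R).comp (continuous_fst.comp continuous_snd)).add
        ((continuous_bumpSq hη R).comp (continuous_snd.comp continuous_snd))).aestronglyMeasurable
    have h2 : AEStronglyMeasurable (fun q : ℝ × (EuclideanSpace ℝ (Fin 3) × EuclideanSpace ℝ (Fin 3)) =>
        lamK (q.2.1 - q.2.2))
        ((volume : Measure (ℝ × (EuclideanSpace ℝ (Fin 3) × EuclideanSpace ℝ (Fin 3)))).restrict (Iio t₀ ×ˢ univ)) :=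
      (measurable_lamK.comp ((measurable_fst.comp measurable_snd).sub
        (measurable_snd.comp measurable_snd))).aestronglyMeasurable
    have h3 := hcont.aestronglyMeasurable hmeasSlab
      (μ := (volume : Measure (ℝ × (EuclideanSpace ℝ (Fin 3) × EuclideanSpace ℝ (Fin 3)))))
    exact h1.mul (h2.mul h3)
  have hΦm : AEStronglyMeasurable Φ (((volume : Measure ℝ).restrict (Iio t₀)).prod volume) := by
    rw [prod_restrict_Iio]; exact hΦm0
  exact (hΦm.integral_prod_right').const_mul (1 / 4 : ℝ)

end Measurability

/-! ### The two-sided pointwise bound -/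

/-- **Two-sided pointwise bound**: for a chiral door-class profile there is `c₀ ≥ 0` such that for all `R > 0`, `t < 0`,
`|locHelicity a_R (curl v(t)) − gagliardo a_R (curl v(t))| ≤ c₀ · E_R(t)` (the Gagliardo–`Λ` IDENTITY for the chiral
vorticity slice; `E_R(t) = R²∫((R‖y‖+√(−t))⁴)⁻¹|Λ a₁(y)| dy`). -/
theorem abs_locHelicity_sub_gagliardo_le {η : EuclideanSpace ℝ (Fin 3) → ℝ} (hη : IsAdmissibleBump η) {C D : ℝ}
    {v : ℝ → EuclideanSpace ℝ (Fin 3) → EuclideanSpace ℝ (Fin 3)}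
    (hrate : HasTypeITimeDecay C v) (hdecay : HasTypeIDecay D v)
    (hcont : ContinuousOn (Function.uncurry v) (Set.Iio (0 : ℝ) ×ˢ Set.univ))
    (hmild : ∀ s t : ℝ, s < t → t < 0 → ∀ x,
      v t x = UnboundedOperators.heatExtension (v s) (t - s) x - oseenDuhamel 1 s v v t x)
    (hdiv : ∀ t < 0, VectorCalculus.IsDivFree (v t)) (hchi : ∀ t < 0, IsChiral (v t)) :
    ∃ c₀ : ℝ, 0 ≤ c₀ ∧ ∀ R > (0 : ℝ), ∀ t < (0 : ℝ),
      |locHelicity (bumpSq η R) (curl (v t)) - gagliardo (bumpSq η R) (curl (v t))| ≤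
        c₀ * (R ^ 2 * ∫ y : EuclideanSpace ℝ (Fin 3),
          ((R * ‖y‖ + Real.sqrt (-t)) ^ 4)⁻¹ * |fracLapHalfS (bumpSq η 1) y|) := by
  obtain ⟨L₁, hL₁, hslice⟩ := vorticity_slice_regularity hrate hdecay hcont hmild hdiv
  set κ : ℝ := ‖(curlCLM : (EuclideanSpace ℝ (Fin 3) →L[ℝ] EuclideanSpace ℝ (Fin 3)) →L[ℝ] EuclideanSpace ℝ (Fin 3))‖
    with hκ
  refine ⟨(1 / 2 : ℝ) * (κ * L₁) ^ 2, by positivity, fun R hR t ht => ?_⟩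
  have hsq : 0 < Real.sqrt (-t) := Real.sqrt_pos.2 (neg_pos.2 ht)
  obtain ⟨hdec, hchiω, N₀, N₁, N₂, hωc, hω0, hω1, hω2⟩ := hslice t ht
  have hac : Continuous (bumpSq η R) := continuous_bumpSq hη R
  have hann : ∀ x, 0 ≤ bumpSq η R x := bumpSq_nonneg η R
  have ha0 : ∀ x, |bumpSq η R x| ≤ 1 := fun x => by
    rw [abs_of_nonneg (hann x)]; exact bumpSq_le_one hη R x
  obtain ⟨A₂, hA₂⟩ := exists_secondDiff_bound_bumpSq hη hR
  have hρ : 0 < 2 * R := by positivity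
  have hsupp : ∀ x : EuclideanSpace ℝ (Fin 3), 2 * R ≤ ‖x‖ → bumpSq η R x = 0 := fun x hx => bumpSq_eq_zero hη hR hx
  have hG := gagliardo_eq_integral_sub hac hann ha0 hA₂ hρ hsupp hωc hω0 hω1 hω2
  have hchi' : IsChiral (curl (v t)) := hchiω (hchi t ht)
  have hhel : (∫ x, bumpSq η R x * ⟪curl (v t) x, fracLapHalf (curl (v t)) x⟫) =
      locHelicity (bumpSq η R) (curl (v t)) := by
    unfold locHelicity
    refine integral_congr_ae (Eventually.of_forall fun x => ?_)
    show bumpSq η R x * ⟪curl (v t) x, fracLapHalf (curl (v t)) x⟫ =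
      bumpSq η R x * ⟪curl (v t) x, curl (curl (v t)) x⟫
    rw [← hchi' x]
  obtain ⟨-, hbook⟩ := integral_normSq_vorticity_mul_abs_fracLapHalfS_le hη hsq hdec hR
  rw [hhel] at hG
  -- `|h − G| = |½ ∫ ‖ω‖² Λ a_R| ≤ ½ ∫ ‖ω‖² |Λ a_R|`
  have hJ : |∫ x, ‖curl (v t) x‖ ^ 2 * fracLapHalfS (bumpSq η R) x| ≤
      ∫ x, ‖curl (v t) x‖ ^ 2 * |fracLapHalfS (bumpSq η R) x| := by
    refine abs_integral_le_integral_abs.trans_eq (integral_congr_ae (Eventually.of_forall fun x => ?_))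
    show |‖curl (v t) x‖ ^ 2 * fracLapHalfS (bumpSq η R) x| = ‖curl (v t) x‖ ^ 2 * |fracLapHalfS (bumpSq η R) x|
    rw [abs_mul, abs_of_nonneg (by positivity : (0 : ℝ) ≤ ‖curl (v t) x‖ ^ 2)]
  rw [hG]
  have e : locHelicity (bumpSq η R) (curl (v t)) -
      (locHelicity (bumpSq η R) (curl (v t)) - (1 / 2 : ℝ) * ∫ x, ‖curl (v t) x‖ ^ 2 * fracLapHalfS (bumpSq η R) x) =
      (1 / 2 : ℝ) * ∫ x, ‖curl (v t) x‖ ^ 2 * fracLapHalfS (bumpSq η R) x := by ring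
  rw [e, abs_mul, abs_of_pos (by norm_num : (0 : ℝ) < 1 / 2), mul_assoc]
  exact mul_le_mul_of_nonneg_left (hJ.trans hbook) (by norm_num)

/-! ### Stub B2′ -/

/-- **Stub B2′ `stub_localDissipationLower` of nsreg-p1 `r19/Sketch20v5.lean` (text verbatim over the tree substrate),
PROVED — LOCALISED HELICITY DISSIPATION IS ALMOST COERCIVE, integrated in time.**  For a chiral door-class profile
and the weights `a_R = η(·/R)²` there is `c` (`= c₀ c₁(η)`, independent of `R > 0` and `t₀ < 0`) with
`∫_{t<t₀} G(a_R, ω(t)) dt ≤ ∫_{t<t₀} ∫ a_R ⟪ω, curl ω⟫ dt + c`: two-sided pointwise bound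
`|h_R − G_R| ≤ c₀E_R` + `∫_{t<0}E_R ≤ c₁(η)` + measurability of `G_R`, `h_R` in `t`; both sides are genuine integrals
or both vanish. -/
theorem localDissipationLower : ∀ (η : EuclideanSpace ℝ (Fin 3) → ℝ), IsAdmissibleBump η → ∀ (C D K : ℝ)
    (v : ℝ → EuclideanSpace ℝ (Fin 3) → EuclideanSpace ℝ (Fin 3)),
    HasTypeITimeDecay C v → HasTypeIDecay D v → HasTypeIDerivDecay K v →
    ContinuousOn (Function.uncurry v) (Set.Iio (0 : ℝ) ×ˢ Set.univ) →
    (∀ s t : ℝ, s < t → t < 0 → ∀ x,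
        v t x = UnboundedOperators.heatExtension (v s) (t - s) x - oseenDuhamel 1 s v v t x) →
    (∀ t < 0, VectorCalculus.IsDivFree (v t)) → (∀ t < 0, IsChiral (v t)) →
    ∃ c : ℝ, ∀ R > (0 : ℝ), ∀ t₀ < (0 : ℝ),
      ∫ t in Set.Iio t₀, gagliardo (bumpSq η R) (curl (v t)) ≤
        (∫ t in Set.Iio t₀, locHelicity (bumpSq η R) (curl (v t))) + c := by
  intro η hη C D K v hrate hdecay _hder hcont hmild hdiv hchi
  obtain ⟨c₀, hc₀, hpt⟩ := abs_locHelicity_sub_gagliardo_le hη hrate hdecay hcont hmild hdiv hchi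
  set c₁ : ℝ := ∫ y : EuclideanSpace ℝ (Fin 3), ‖y‖ ^ (-(2 : ℝ)) * |fracLapHalfS (bumpSq η 1) y| with hc₁
  have hc₁nn : 0 ≤ c₁ := integral_nonneg fun y => by positivity
  -- joint smoothness of the profile on the open backward slab
  have hsmooth : ContDiffOn ℝ 2 (uncurry v) (Iio (0 : ℝ) ×ˢ univ) :=
    (isTypeIAncientMild_of_class hrate hcont hmild hdiv).1.of_le (by norm_cast)
  refine ⟨c₀ * c₁, fun R hR t₀ ht₀ => ?_⟩
  -- abbreviations
  set G : ℝ → ℝ := fun t => gagliardo (bumpSq η R) (curl (v t)) with hGdef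
  set h : ℝ → ℝ := fun t => locHelicity (bumpSq η R) (curl (v t)) with hhdef
  set E : ℝ → ℝ := fun t => R ^ 2 * ∫ y : EuclideanSpace ℝ (Fin 3),
    ((R * ‖y‖ + Real.sqrt (-t)) ^ 4)⁻¹ * |fracLapHalfS (bumpSq η 1) y| with hEdef
  show ∫ t in Iio t₀, G t ≤ (∫ t in Iio t₀, h t) + c₀ * c₁
  -- the error: integrable on `Iio t₀` with integral `≤ c₁`
  obtain ⟨hEi0, hEval0⟩ := timeIntegratedError_le hη hR
  have hEnn : ∀ t, 0 ≤ E t := fun t => by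
    rw [hEdef]; dsimp only
    exact mul_nonneg (sq_nonneg R) (integral_nonneg fun y => by positivity)
  have hsubset : Iio t₀ ⊆ Iio (0 : ℝ) := Iio_subset_Iio ht₀.le
  have hEi : IntegrableOn E (Iio t₀) := hEi0.mono_set hsubset
  have hEval : ∫ t in Iio t₀, E t ≤ c₁ :=
    (setIntegral_mono_set hEi0 (ae_of_all _ hEnn) (ae_of_all _ hsubset)).trans hEval0
  -- measurability of `G` and `h` in `t`
  have hGm : AEStronglyMeasurable G (volume.restrict (Iio t₀)) := aestronglyMeasurable_gagliardo_curl hsmooth hη R ht₀.le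
  have hhm : AEStronglyMeasurable h (volume.restrict (Iio t₀)) := aestronglyMeasurable_locHelicity_curl hsmooth hη R ht₀.le
  -- the two-sided pointwise bounds, a.e. on `Iio t₀`
  have hGnn : ∀ t, 0 ≤ G t := fun t => gagliardo_nonneg (bumpSq_nonneg η R) _
  have hbd : ∀ t, t < t₀ → |h t - G t| ≤ c₀ * E t := fun t ht => hpt R hR t (ht.trans ht₀)
  have hG_le : ∀ᵐ t ∂(volume.restrict (Iio t₀)), ‖G t‖ ≤ h t + c₀ * E t := by
    refine (ae_restrict_iff' measurableSet_Iio).2 (ae_of_all _ fun t ht => ?_)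
    have h1 := hbd t ht
    rw [Real.norm_eq_abs, abs_of_nonneg (hGnn t)]
    linarith [(abs_le.1 h1).1, (abs_le.1 h1).2]
  have hh_le : ∀ᵐ t ∂(volume.restrict (Iio t₀)), ‖h t‖ ≤ G t + c₀ * E t := by
    refine (ae_restrict_iff' measurableSet_Iio).2 (ae_of_all _ fun t ht => ?_)
    have h1 := hbd t ht
    rw [Real.norm_eq_abs]
    have := hGnn t
    rw [abs_le]
    constructor <;> linarith [(abs_le.1 h1).1, (abs_le.1 h1).2]
  by_cases hGi : IntegrableOn G (Iio t₀)
  · -- both integrable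
    have hhi : IntegrableOn h (Iio t₀) := Integrable.mono' (hGi.add (hEi.const_mul c₀)) hhm hh_le
    calc ∫ t in Iio t₀, G t ≤ ∫ t in Iio t₀, (h t + c₀ * E t) :=
          integral_mono_ae hGi (hhi.add (hEi.const_mul c₀)) (hG_le.mono fun t ht => by
            rw [Real.norm_eq_abs, abs_of_nonneg (hGnn t)] at ht; exact ht)
      _ = (∫ t in Iio t₀, h t) + c₀ * ∫ t in Iio t₀, E t := by
          rw [integral_add hhi (hEi.const_mul c₀), integral_const_mul]
      _ ≤ (∫ t in Iio t₀, h t) + c₀ * c₁ := by gcongr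
  · -- neither integrable: both integrals vanish
    have hhi : ¬ IntegrableOn h (Iio t₀) := fun hhi =>
      hGi (Integrable.mono' (hhi.add (hEi.const_mul c₀)) hGm hG_le)
    rw [integral_undef hGi, integral_undef hhi, zero_add]
    positivity

end Summit.NavierStokesRegularity.NavierStokesRegularity.Theorems.ChiralWindowDoorLocalDissipationLower
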